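import Summits.AtomisticToContinuum.Crystallization.Theses.LaminarSixThreeThree
import Literature.MathematicalPhysics.StatisticalMechanics.LennardJonesClusters

/-!
# Local frames, counting side: from the radius-2 energy inequality and local rigidity to Barlow windows a.e.

Crux `StackingFaultSparsity` (stmt-AtomisticToContinuum-14296), line `Sketch`, reshape 11, the lead's glue — part 1
(counting; no geometry).  Three inputs, all taken as explicit hypotheses (two are registered stubs of the line, the
third is the statement the geometric stubs S0/S12/S3/S4 deliver through the lead's contradiction argument):

* the LOCAL RIGIDITY statement `QR2`: for every `R` and `ε > 0` there is a radius `m` such that, for every finite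
  configuration, if every particle within `m` of `y i` has a GOOD `(2, 1, 1/(m+1))`-window of its own, then the
  `R`-window of `y i` is two-way `ε`-matched after a linear isometry to a window of some `barlowStacking a h s`;
* the registered stub `stub_energyGap` of crux 14294 (laminar local energy inequality at window radius `2`);
* `LjLaminarity` (item 14293).

Output: `LaminarBarlowWindows` (item 14292).  Steps: `tendsto_density_of_gap` (real-analysis squeeze, the
radius-2 case of the assembly of `Cruxes/LaminarSaturation/Lines/birth.lean`), `goodTwo_density_tendsto` (a.e.
GOOD(2,1,ε) windows along ground states, using the PROVED `CrysEnergyLimit_holds`), `card_near_le` /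
`card_exists_near_not_le` (packing count from the PROVED uniform minimal distance `LennardJonesMinimalDistance_holds`),
`allGoodBall_density_tendsto` (a.e. all-GOOD `m`-balls), `laminarBarlowWindows_of_localRigidity` (registered helper of
`stub_leadGlue`).  All `[folklore]` bookkeeping.
-/

noncomputable section

namespace Summit.AtomisticToContinuum.Crystallization.Theorems.SquareWellLayerCake.StackingFaultSparsity.LocalFrames.Counting

open Filter Topology
open Literature.MathematicalPhysics.StatisticalMechanics
open Summit.AtomisticToContinuum.Crystallization.Theses.LaminarSixThreeThree

/-- Real-analysis core (radius-2 case of the squeeze of 14294's birth assembly): a density `f/N` with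
`γ f ≤ (E − N e) + C g + s` tends to `0` when `E/N → e`, `g/N → 0`, `s/N → 0`. [folklore] -/
theorem tendsto_density_of_gap {f g E s : ℕ → ℝ} {γ C e : ℝ} (hγ : 0 < γ)
    (hgap : ∀ N, γ * f N ≤ (E N - (N : ℝ) * e) + C * g N + s N) (hf : ∀ N, 0 ≤ f N)
    (hg : Tendsto (fun N : ℕ => g N / (N : ℝ)) atTop (𝓝 0))
    (hE : Tendsto (fun N : ℕ => E N / (N : ℝ)) atTop (𝓝 e))
    (hs : Tendsto (fun N : ℕ => s N / (N : ℝ)) atTop (𝓝 0)) :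
    Tendsto (fun N : ℕ => f N / (N : ℝ)) atTop (𝓝 0) := by
  have hup : Tendsto (fun N : ℕ => ((E N / (N : ℝ) - e) + C * (g N / (N : ℝ)) + s N / (N : ℝ)) / γ)
      atTop (𝓝 0) := by
    have h1 : Tendsto (fun N : ℕ => E N / (N : ℝ) - e) atTop (𝓝 0) := by simpa using hE.sub_const e
    simpa using ((h1.add (hg.const_mul C)).add hs).div_const γ
  refine tendsto_of_tendsto_of_tendsto_of_le_of_le' tendsto_const_nhds hup ?_ ?_
  · exact Filter.Eventually.of_forall fun N => div_nonneg (hf N) (Nat.cast_nonneg N)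
  · filter_upwards [Filter.eventually_gt_atTop 0] with N hN
    have hN : (0 : ℝ) < N := Nat.cast_pos.mpr hN
    have hb : f N ≤ ((E N - (N : ℝ) * e) + C * g N + s N) / γ := by
      rw [le_div_iff₀ hγ]; linarith [hgap N]
    have hdiv : f N / (N : ℝ) ≤ ((E N - (N : ℝ) * e) + C * g N + s N) / γ / (N : ℝ) :=
      div_le_div_of_nonneg_right hb hN.le
    refine hdiv.trans (le_of_eq ?_)
    field_simp

/-- **A.e. GOOD `(2, 1, ε)` windows along ground states**, from 14294's radius-2 energy inequality, `LjLaminarity` and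
the proved energy limit `CrysEnergyLimit_holds`. [folklore] -/
theorem goodTwo_density_tendsto
    (hE : ∀ ε : ℝ, 0 < ε → ∃ t R₀ γ C : ℝ, 0 < t ∧ 0 < R₀ ∧ 0 < γ ∧ 0 ≤ C ∧ ∃ s : ℕ → ℝ, Filter.Tendsto (fun N : ℕ => s N / (N : ℝ)) Filter.atTop (nhds 0) ∧ ∀ (N : ℕ) (y : Fin N → EuclideanSpace ℝ (Fin 3)), Literature.MathematicalPhysics.StatisticalMechanics.IsGroundState Literature.MathematicalPhysics.StatisticalMechanics.lennardJones y → γ * (Nat.card {i : Fin N // ¬ (∃ a b : ℝ, 19 / 20 ≤ a ∧ a ≤ 1 ∧ 19 / 20 ≤ b ∧ b ≤ 1 ∧ ∃ n : EuclideanSpace ℝ (Fin 3), ‖n‖ = 1 ∧ ∃ c : ℤ → ℝ, (∀ k : ℤ, c k + 19 / 25 ≤ c (k + 1)) ∧ ∃ l : Fin N → ℤ, (∀ j : Fin N, dist (y j) (y i) ≤ 2 → |inner ℝ (y j - y i) n - c (l j)| ≤ ε) ∧ (∀ j k : Fin N, dist (y j) (y i) ≤ 2 → dist (y k) (y i) ≤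 2 → j ≠ k → 19 / 20 ≤ dist (y j) (y k)) ∧ ∀ j : Fin N, dist (y j) (y i) ≤ 1 → Nat.card {k : Fin N // k ≠ j ∧ l k = l j ∧ dist (y j) (y k) ≤ 1} = 6 ∧ Nat.card {k : Fin N // l k = l j + 1 ∧ dist (y j) (y k) ≤ 1} = 3 ∧ Nat.card {k : Fin N // l k = l j - 1 ∧ dist (y j) (y k) ≤ 1} = 3 ∧ ∀ k : Fin N, k ≠ j → dist (y j) (y k) ≤ 1 → (l k = l j → |dist (y j) (y k) - a| ≤ ε) ∧ (l k ≠ l j → |dist (y j) (y k) - b| ≤ ε))} : ℝ) ≤ (Literature.MathematicalPhysics.StatisticalMechanics.interactionEnergy Literature.MathematicalPhysics.StatisticalMechanics.lennardJones y - (N : ℝ) * (⨅ Q : Literature.MathematicalPhysics.StatisticalMechanics.PeriodicConfiguration 3, Q.energyPerParticle Literature.MathematicalPhysics.StatisticalMechanics.lennardJones)) + C * (Nat.card {i : Fin N // ¬ (∃ n : EuclideanSpace ℝ (Fin 3), ‖n‖ = 1 ∧ ∃ c : ℤ → ℝ, (∀ k : ℤ, c k + 3 / 4 ≤ c (k + 1))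 ∧ ∀ j : Fin N, dist (y j) (y i) ≤ R₀ → ∃ k : ℤ, |inner ℝ (y j - y i) n - c k| ≤ t)} : ℝ) + s N)
    (hLam : LjLaminarity) :
    ∀ ε : ℝ, 0 < ε → ∀ x : (N : ℕ) → (Fin N → EuclideanSpace ℝ (Fin 3)), (∀ N, IsGroundState lennardJones (x N)) →
      Tendsto (fun N : ℕ => (Nat.card {i : Fin N // ¬ (∃ a b : ℝ, 19 / 20 ≤ a ∧ a ≤ 1 ∧ 19 / 20 ≤ b ∧ b ≤ 1 ∧ ∃ n : EuclideanSpace ℝ (Fin 3), ‖n‖ = 1 ∧ ∃ c : ℤ → ℝ, (∀ k : ℤ, c k + 19 / 25 ≤ c (k + 1)) ∧ ∃ l : Fin N → ℤ, (∀ j : Fin N, dist (x N j) (x N i) ≤ 2 → |inner ℝ (x N j - x N i) n - c (l j)| ≤ ε) ∧ (∀ j k : Fin N, dist (x N j) (x N i) ≤ 2 → dist (x N k) (x N i) ≤ 2 → j ≠ k → 19 / 20 ≤ dist (x N j) (x N k)) ∧ ∀ j : Fin N, dist (x N j) (x N i) ≤ 1 → Nat.card {k : Fin N // k ≠ j ∧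 l k = l j ∧ dist (x N j) (x N k) ≤ 1} = 6 ∧ Nat.card {k : Fin N // l k = l j + 1 ∧ dist (x N j) (x N k) ≤ 1} = 3 ∧ Nat.card {k : Fin N // l k = l j - 1 ∧ dist (x N j) (x N k) ≤ 1} = 3 ∧ ∀ k : Fin N, k ≠ j → dist (x N j) (x N k) ≤ 1 → (l k = l j → |dist (x N j) (x N k) - a| ≤ ε) ∧ (l k ≠ l j → |dist (x N j) (x N k) - b| ≤ ε))} : ℝ) / N) atTop (𝓝 0) := by
  intro ε hε x hx
  obtain ⟨t, R₀, γ, C, ht, hR₀, hγ, _hC, s, hs, hgap⟩ := hE ε hε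
  have h0 : Tendsto (fun N : ℕ => groundStateEnergy lennardJones 3 N / (N : ℝ)) atTop
      (𝓝 (⨅ Q : PeriodicConfiguration 3, Q.energyPerParticle lennardJones)) := CrysEnergyLimit_holds
  exact tendsto_density_of_gap hγ (fun N => hgap N (x N) (hx N)) (fun N => Nat.cast_nonneg _)
    (hLam t R₀ ht hR₀ x hx) (h0.congr fun N => by rw [(hx N).2]) hs

/-- Fibre count: sites within `D` of a fixed site of a `δ`-separated configuration number at most `(2D/δ + 1)³`
(`card_le_of_separated_of_dist_le`). [folklore] -/
theorem card_near_le {N : ℕ} (X : Fin N → EuclideanSpace ℝ (Fin 3)) (j : Fin N) {D δ : ℝ} (hD : 0 ≤ D) (hδ : 0 < δ)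
    (hsep : ∀ i k : Fin N, i ≠ k → δ ≤ dist (X i) (X k)) (F : Finset (Fin N))
    (hF : ∀ i ∈ F, dist (X i) (X j) ≤ D) : (F.card : ℝ) ≤ (2 * D / δ + 1) ^ 3 := by
  have hinj : Set.InjOn X F := fun i _ i' _ hii' => by
    by_contra hne
    have h := hsep i i' hne
    rw [hii', dist_self] at h
    exact absurd h (not_le.2 hδ)
  rw [← Finset.card_image_of_injOn hinj]
  have h := card_le_of_separated_of_dist_le (F.image X) (X j) hδ hD ?_ ?_
  · rwa [finrank_euclideanSpace_fin] at h
  · intro c hc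
    obtain ⟨i, hi, rfl⟩ := Finset.mem_image.1 hc
    exact hF i hi
  · intro c hc d hd hne
    obtain ⟨i, _, rfl⟩ := Finset.mem_image.1 hc
    obtain ⟨i', _, rfl⟩ := Finset.mem_image.1 hd
    exact hsep i i' fun h => hne (congrArg X h)

/-- Counting: in a `δ`-separated configuration the sites having a non-`P` site within distance `D` number at most
`(2D/δ + 1)³` times the non-`P` sites. [folklore] -/
theorem card_exists_near_not_le {N : ℕ} (X : Fin N → EuclideanSpace ℝ (Fin 3)) {D δ : ℝ} (hD : 0 ≤ D) (hδ : 0 < δ)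
    (hsep : ∀ i k : Fin N, i ≠ k → δ ≤ dist (X i) (X k)) (P : Fin N → Prop) :
    (Nat.card {i : Fin N // ¬ ∀ j : Fin N, dist (X j) (X i) ≤ D → P j} : ℝ) ≤
      (2 * D / δ + 1) ^ 3 * Nat.card {i : Fin N // ¬ P i} := by
  classical
  rw [Nat.card_eq_fintype_card, Fintype.card_subtype, Nat.card_eq_fintype_card, Fintype.card_subtype]
  set Bad := Finset.univ.filter fun i : Fin N => ¬ P i with hBad
  set BadD := Finset.univ.filter fun i : Fin N => ¬ ∀ j : Fin N, dist (X j) (X i) ≤ D → P j with hBadD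
  set Fib : Fin N → Finset (Fin N) := fun j => Finset.univ.filter fun i : Fin N => dist (X i) (X j) ≤ D
    with hFib
  have hcover : BadD ⊆ Bad.biUnion Fib := by
    intro i hi
    simp only [hBadD, Finset.mem_filter, Finset.mem_univ, true_and] at hi
    push Not at hi
    obtain ⟨j, hj, hjbad⟩ := hi
    rw [Finset.mem_biUnion]
    refine ⟨j, ?_, ?_⟩
    · simpa only [hBad, Finset.mem_filter, Finset.mem_univ, true_and] using hjbad
    · simp only [hFib, Finset.mem_filter, Finset.mem_univ, true_and]
      rwa [dist_comm]
  have hfib : ∀ j ∈ Bad, ((Fib j).card : ℝ) ≤ (2 * D / δ + 1) ^ 3 := fun j _ =>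
    card_near_le X j hD hδ hsep (Fib j) fun i hi => by
      simp only [hFib, Finset.mem_filter, Finset.mem_univ, true_and] at hi
      exact hi
  have h1 : (BadD.card : ℝ) ≤ (Bad.biUnion Fib).card := by exact_mod_cast Finset.card_le_card hcover
  have h2 : ((Bad.biUnion Fib).card : ℝ) ≤ Bad.card * (2 * D / δ + 1) ^ 3 :=
    calc ((Bad.biUnion Fib).card : ℝ) ≤ ∑ j ∈ Bad, ((Fib j).card : ℝ) := by
          exact_mod_cast Finset.card_biUnion_le
      _ ≤ ∑ j ∈ Bad, (2 * D / δ + 1) ^ 3 := Finset.sum_le_sum hfib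
      _ = Bad.card * (2 * D / δ + 1) ^ 3 := by rw [Finset.sum_const, nsmul_eq_mul]
  linarith

/-- **A.e. all-GOOD `m`-balls**: if along every ground-state sequence the density of particles without a GOOD
`(2, 1, ε)`-window tends to `0`, then so does the density of particles having SOME particle without one within
distance `m` (packing count with the proved uniform minimal distance of LJ ground states). [folklore] -/
theorem allGoodBall_density_tendsto (m : ℕ) (ε : ℝ)
    (hG : ∀ x : (N : ℕ) → (Fin N → EuclideanSpace ℝ (Fin 3)), (∀ N, IsGroundState lennardJones (x N)) →
      Tendsto (fun N : ℕ => (Nat.card {i : Fin N // ¬ (∃ a b : ℝ, 19 / 20 ≤ a ∧ a ≤ 1 ∧ 19 / 20 ≤ b ∧ b ≤ 1 ∧ ∃ n : EuclideanSpace ℝ (Fin 3), ‖n‖ = 1 ∧ ∃ c : ℤ → ℝ, (∀ k : ℤ, c k + 19 / 25 ≤ c (k + 1)) ∧ ∃ l : Fin N → ℤ, (∀ j : Fin N, dist (x N j) (x N i) ≤ 2 → |inner ℝ (x N j - x N i) n - c (l j)| ≤ ε) ∧ (∀ j k : Fin N, dist (x N j) (x N i) ≤ 2 → dist (x N k) (x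 N i) ≤ 2 → j ≠ k → 19 / 20 ≤ dist (x N j) (x N k)) ∧ ∀ j : Fin N, dist (x N j) (x N i) ≤ 1 → Nat.card {k : Fin N // k ≠ j ∧ l k = l j ∧ dist (x N j) (x N k) ≤ 1} = 6 ∧ Nat.card {k : Fin N // l k = l j + 1 ∧ dist (x N j) (x N k) ≤ 1} = 3 ∧ Nat.card {k : Fin N // l k = l j - 1 ∧ dist (x N j) (x N k) ≤ 1} = 3 ∧ ∀ k : Fin N, k ≠ j → dist (x N j) (x N k) ≤ 1 → (l k = l j → |dist (x N j) (x N k) - a| ≤ ε) ∧ (l k ≠ l j → |dist (x N j) (x N k) - b| ≤ ε))} : ℝ) / N) atTop (𝓝 0)) :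
    ∀ x : (N : ℕ) → (Fin N → EuclideanSpace ℝ (Fin 3)), (∀ N, IsGroundState lennardJones (x N)) →
      Tendsto (fun N : ℕ => (Nat.card {i : Fin N // ¬ ∀ jc : Fin N, dist (x N jc) (x N i) ≤ (m : ℝ) →
        (∃ a b : ℝ, 19 / 20 ≤ a ∧ a ≤ 1 ∧ 19 / 20 ≤ b ∧ b ≤ 1 ∧ ∃ n : EuclideanSpace ℝ (Fin 3), ‖n‖ = 1 ∧ ∃ c : ℤ → ℝ, (∀ k : ℤ, c k + 19 / 25 ≤ c (k + 1)) ∧ ∃ l : Fin N → ℤ, (∀ j : Fin N, dist (x N j) (x N jc) ≤ 2 → |inner ℝ (x N j - x N jc) n - c (l j)| ≤ ε) ∧ (∀ j k : Fin N, dist (x N j) (x N jc) ≤ 2 → dist (x N k) (x N jc) ≤ 2 → j ≠ k → 19 / 20 ≤ dist (x N j) (x N k)) ∧ ∀ j : Fin N, dist (x N j) (x N jc) ≤ 1 → Nat.card {k : Fin N // k ≠ j ∧ l k = l j ∧ dist (x N j) (x N k) ≤ 1} = 6 ∧ Nat.card {k : Fin N // l k = l j + 1 ∧ dist (x N j) (x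 N k) ≤ 1} = 3 ∧ Nat.card {k : Fin N // l k = l j - 1 ∧ dist (x N j) (x N k) ≤ 1} = 3 ∧ ∀ k : Fin N, k ≠ j → dist (x N j) (x N k) ≤ 1 → (l k = l j → |dist (x N j) (x N k) - a| ≤ ε) ∧ (l k ≠ l j → |dist (x N j) (x N k) - b| ≤ ε))} : ℝ) / N) atTop (𝓝 0) := by
  intro x hx
  obtain ⟨δ, hδ, hsep⟩ := LennardJonesMinimalDistance_holds
  have hm : (0 : ℝ) ≤ m := Nat.cast_nonneg m
  have hC := (hG x hx).const_mul ((2 * (m : ℝ) / δ + 1) ^ 3)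
  rw [mul_zero] at hC
  refine squeeze_zero (fun N => by positivity) (fun N => ?_) hC
  rw [mul_div_assoc']
  exact div_le_div_of_nonneg_right
    (card_exists_near_not_le (x N) hm hδ (fun i k hik => hsep N (x N) (hx N) i k hik) _) (Nat.cast_nonneg N)

/-- **Registered helper of `stub_leadGlue` (counting side): local rigidity + the radius-2 energy stub + laminarity
⇒ `LaminarBarlowWindows` (item 14292).**  At the target `(R, ε)` take the radius `m` of local rigidity; the
non-Barlow-matched particles are among those whose `m`-ball is not all-GOOD at tolerance `1/(m+1)`, whose density tends
to `0`. [folklore] -/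
theorem laminarBarlowWindows_of_localRigidity :
    (∀ R ε : ℝ, 0 < ε → ∃ m : ℕ, ∀ (N : ℕ) (y : Fin N → EuclideanSpace ℝ (Fin 3)) (i : Fin N), (∀ jc : Fin N, dist (y jc) (y i) ≤ (m : ℝ) → (∃ a b : ℝ, 19 / 20 ≤ a ∧ a ≤ 1 ∧ 19 / 20 ≤ b ∧ b ≤ 1 ∧ ∃ n : EuclideanSpace ℝ (Fin 3), ‖n‖ = 1 ∧ ∃ c : ℤ → ℝ, (∀ k : ℤ, c k + 19 / 25 ≤ c (k + 1)) ∧ ∃ l : Fin N → ℤ, (∀ j : Fin N, dist (y j) (y jc) ≤ 2 → |inner ℝ (y j - y jc) n - c (l j)| ≤ 1 / ((m : ℝ) + 1)) ∧ (∀ j k : Fin N, dist (y j) (y jc) ≤ 2 → dist (y k) (y jc) ≤ 2 → j ≠ k → 19 / 20 ≤ dist (y j) (y k)) ∧ ∀ j : Fin N, dist (y j) (y jc) ≤ 1 → Nat.card {k : Fin N // k ≠ j ∧ l k = l j ∧ dist (y j) (y k) ≤ 1} = 6 ∧ Nat.card {k : Fin N // l k = l j + 1 ∧ dist (y j) (y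 k) ≤ 1} = 3 ∧ Nat.card {k : Fin N // l k = l j - 1 ∧ dist (y j) (y k) ≤ 1} = 3 ∧ ∀ k : Fin N, k ≠ j → dist (y j) (y k) ≤ 1 → (l k = l j → |dist (y j) (y k) - a| ≤ 1 / ((m : ℝ) + 1)) ∧ (l k ≠ l j → |dist (y j) (y k) - b| ≤ 1 / ((m : ℝ) + 1)))) → ∃ a h : ℝ, 1 / 2 < a ∧ a < 2 ∧ 1 / 2 < h ∧ h < 2 ∧ ∃ s : ℤ → ℤ, Literature.MathematicalPhysics.StatisticalMechanics.IsHaggSeq s ∧ ∃ z ∈ Literature.MathematicalPhysics.StatisticalMechanics.barlowStacking a h s, ∃ A : EuclideanSpace ℝ (Fin 3) →ₗᵢ[ℝ] EuclideanSpace ℝ (Fin 3), (∀ p ∈ Literature.MathematicalPhysics.StatisticalMechanics.barlowStacking a h s, dist p z ≤ R → ∃ j : Fin N, dist (y j) (y i + A (p - z)) ≤ ε) ∧ (∀ j : Fin N, dist (y j) (y i) ≤ R → ∃ p ∈ Literature.MathematicalPhysics.StatisticalMechanics.barlowStacking a h s, dist (y j) (y i + A (p - z)) ≤ ε)) → (∀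 ε : ℝ, 0 < ε → ∃ t R₀ γ C : ℝ, 0 < t ∧ 0 < R₀ ∧ 0 < γ ∧ 0 ≤ C ∧ ∃ s : ℕ → ℝ, Filter.Tendsto (fun N : ℕ => s N / (N : ℝ)) Filter.atTop (nhds 0) ∧ ∀ (N : ℕ) (y : Fin N → EuclideanSpace ℝ (Fin 3)), Literature.MathematicalPhysics.StatisticalMechanics.IsGroundState Literature.MathematicalPhysics.StatisticalMechanics.lennardJones y → γ * (Nat.card {i : Fin N // ¬ (∃ a b : ℝ, 19 / 20 ≤ a ∧ a ≤ 1 ∧ 19 / 20 ≤ b ∧ b ≤ 1 ∧ ∃ n : EuclideanSpace ℝ (Fin 3), ‖n‖ = 1 ∧ ∃ c : ℤ → ℝ, (∀ k : ℤ, c k + 19 / 25 ≤ c (k + 1)) ∧ ∃ l : Fin N → ℤ, (∀ j : Fin N, dist (y j) (y i) ≤ 2 → |inner ℝ (y j - y i) n - c (l j)| ≤ ε) ∧ (∀ j k : Fin N, dist (y j) (y i) ≤ 2 → dist (y k) (y i) ≤ 2 → j ≠ k → 19 / 20 ≤ dist (y j) (y k)) ∧ ∀ j : Fin N, dist (y j)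 (y i) ≤ 1 → Nat.card {k : Fin N // k ≠ j ∧ l k = l j ∧ dist (y j) (y k) ≤ 1} = 6 ∧ Nat.card {k : Fin N // l k = l j + 1 ∧ dist (y j) (y k) ≤ 1} = 3 ∧ Nat.card {k : Fin N // l k = l j - 1 ∧ dist (y j) (y k) ≤ 1} = 3 ∧ ∀ k : Fin N, k ≠ j → dist (y j) (y k) ≤ 1 → (l k = l j → |dist (y j) (y k) - a| ≤ ε) ∧ (l k ≠ l j → |dist (y j) (y k) - b| ≤ ε))} : ℝ) ≤ (Literature.MathematicalPhysics.StatisticalMechanics.interactionEnergy Literature.MathematicalPhysics.StatisticalMechanics.lennardJones y - (N : ℝ) * (⨅ Q : Literature.MathematicalPhysics.StatisticalMechanics.PeriodicConfiguration 3, Q.energyPerParticle Literature.MathematicalPhysics.StatisticalMechanics.lennardJones)) + C * (Nat.card {i : Fin N // ¬ (∃ n : EuclideanSpace ℝ (Fin 3), ‖n‖ = 1 ∧ ∃ c : ℤ → ℝ, (∀ k : ℤ, c k + 3 / 4 ≤ c (k + 1)) ∧ ∀ j : Fin N, dist (y j) (y i) ≤ R₀ → ∃ k : ℤ, |inner ℝ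 (y j - y i) n - c k| ≤ t)} : ℝ) + s N) → LjLaminarity → LaminarBarlowWindows := by
  intro hQR hE hLam R ε _hR hε _hε4 x hx
  obtain ⟨m, hm⟩ := hQR R ε hε
  have hT := allGoodBall_density_tendsto m (1 / ((m : ℝ) + 1))
    (goodTwo_density_tendsto hE hLam (1 / ((m : ℝ) + 1)) (by positivity)) x hx
  refine squeeze_zero (fun N => by positivity) (fun N => ?_) hT
  refine div_le_div_of_nonneg_right (Nat.cast_le.mpr ?_) (Nat.cast_nonneg N)
  refine Nat.card_le_card_of_injective
    (Subtype.map id fun i hi hgood => hi ?_) (Subtype.map_injective _ Function.injective_id)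
  exact hm N (x N) i hgood

end Summit.AtomisticToContinuum.Crystallization.Theorems.SquareWellLayerCake.StackingFaultSparsity.LocalFrames.Counting

end
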